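import Literature.Barriers.ABC.SzpiroEpsilonCannotBeDropped
import Literature.NumberTheory.EllipticCurves.SzpiroFreyCurveProofs
import HarnessLib

/-!
# Sharpness of the exponent `6` in Szpiro's conjecture: proof of
`bennettYazdani2012_minOrd_ge_six`

Sibling proof file of `SzpiroEpsilonCannotBeDropped.lean` (D-0014); theorems only, no new
definitions. We PROVE the named fact `Literature.Barriers.ABC.bennettYazdani2012_minOrd_ge_six`
(Bennett–Yazdani, *A local version of Szpiro's conjecture*, Exp. Math. 21 (2012), §7,
Proposition 7.4, "in particular" clause): there are infinitely many pairwise non-`ℚ`-isomorphic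
semistable elliptic curves `E/ℚ` with `ord_p (Δ_min(E)) ≥ 6` at every prime `p ∣ Δ_min(E)`.

Bennett–Yazdani obtain such curves from rational points of the twisted modular curve `X_F(6)`
(a genus-one curve, via Rubin–Silverberg's description of `X_F(2)`, `X_F(3)` and explicit maps,
Lemmas 7.1–7.3, pp. 17–18), which is far beyond the present library. The proof below is a
different, elementary construction in the same spirit — level-`3` structure plus rational points
of an auxiliary genus-one curve — that only uses the tree's local theory of Weierstrass equations
over `ℤ` (`SzpiroLocalDataProofs`, `SzpiroFreyCurveProofs`: minimality via `p ∤ c₄`, reduction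
type read off from `(ord_p Δ, ord_p c₄)`, `ord_p (Δ_min)` of a minimal equation, isomorphism
invariance of `ord_p (Δ_min)`):

1. *The equations.* For integers `a, b` the curve `y² + a xy + b y = x³` has `c₄ = a (a³ − 24 b)`
   and `Δ = b³ (a³ − 27 b)`. If `a, b` are coprime and `3 ∤ a`, no prime divides both, so the
   equation is minimal and semistable at every prime and `ord_p (Δ_min) = ord_p (b³ (a³ − 27 b))`
   (`isSemistableAt_mk`, `le_ordMinimalDiscriminant_mk_iff`). If moreover `a³ − 27 b = n³` is a
   cube (these are the curves with `E[3] ≅ ℤ/3 × μ₃`, a model of the Hesse pencil) and `b n` is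
   powerful, then `Δ_min = (b n)³` has all its nonzero exponents `≥ 6`
   (`six_le_ordMinimalDiscriminant_mk`).
2. *The parameters.* Take `a = m` and `27 b = m³ − n³` for a fraction `λ = m/n` in lowest terms,
   so that `a³ − 27 b = n³` automatically; it remains to make `b n` powerful (with `m, b` coprime,
   `3 ∤ m`). On the Mordell curve `Y² = X³ − 216` put `λ = (X + 12)/(X − 6)`; then
   `λ³ − 1 = 54 (X³ − 216)/(X − 6)⁴` is `6` times a rational square (`lam_cube_sub_one`), whence
   `b n = 2 z²` and every prime `p ≥ 5` divides `b n` to an even power; at `p = 2, 3` one uses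
   instead that the point is `2`- and `3`-adically close to the origin: `ord₂ (X) ≤ −2`,
   `ord₃ (X) ≤ −2` give `2^{1 − ord₂ X} ∣ b` and `9 ∣ b` (`exists_params`).
3. *Infinitely many points.* Starting from the point `6 · (10, 28)` of `Y² = X³ − 216`, which
   lies in both formal groups (`exists_start`, checked numerically by `norm_num`), the
   `x`-coordinate duplication `X ↦ (X⁴ + 1728 X)/(4 (X³ − 216))` keeps producing points with
   `ord₃ ≤ −2` and lowers `ord₂` by `2` each time (`orbit`); so the `2`-exponent
   `ord₂ (Δ_min) ≥ 3 (1 − ord₂ X_j) = 9 + 6 j` is unbounded along the orbit, and since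
   `ord₂ (Δ_min)` is a `ℚ`-isomorphism invariant (`ordMinimalDiscriminant_smul_holds`) the curves
   escape any finite set of isomorphism classes.

All auxiliary statements are elementary and tagged `[folklore]`; the cited source is used only for
the statement being proved.

## Audit addendum (2026-08-15, barrier audit D-0021 of this file)

* *Transcription re-checked on the page.* Exp. Math. 21 (2012), p. 18 prints Proposition 7.4
  exactly as quoted in the statement file, ending "In particular, `min_{p∣Δ_E} v_p(Δ_E) ≥ 6`";
  p. 4: "Section 7 is devoted to a construction which produces infinitely many curves `E/ℚ` for
  which `min {v_p(Δ(E)) : p ∣ Δ(E)} ≥ 6` (whereby Conjecture 1.2, if true, is necessarily sharp).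
  This provides an alternate proof to that given by Masser in [3], that the same is true for
  Szpiro's Conjecture"; p. 19: "From our construction, it appears to be somewhat difficult to
  deduce lower bounds of the flavour of (6)." [cite: BennettYazdani2012, §1 p. 4, §7 Prop. 7.4 and p. 19]
* *What the named fact supports.* `bennettYazdani2012_minOrd_ge_six` (semistable, every nonzero
  `ord_p (Δ_min) ≥ 6`, infinitely many classes) yields `|Δ_min| ≥ N_E⁶` for infinitely many
  semistable `E` — the exponent `6` cannot be LOWERED ("sharp") — but by itself it does not refute
  `|Δ_min| ≤ C · N_E⁶` for a constant `C ≥ 1`, let alone the polylogarithmic form of the barrier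
  `SzpiroEpsilonCannotBeDropped` (now proved in the sibling `SzpiroEpsilonCannotBeDroppedHolds`,
  after Masser). The construction of this file does more than the named fact records: along the
  orbit `ord₂ (Δ_min) = 9 + 6j` is unbounded while the conductor stays squarefree, so
  `|Δ_min| / N_E⁶ ≥ 2^{3+6j} → ∞`. This is made explicit below (`BennettYazdani.conductorExponent_mk_eq`,
  `BennettYazdani.conductorNorm_sq_mul_dvd`, `exists_semistable_minOrd_ge_six_excess_ge`: for every `B` a
  semistable curve of the family with `min ord ≥ 6` and `|Δ_min| ≥ B · N_E⁶`) — in particular a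
  second, independent in-tree refutation of the `ε = 0` clause of the barrier's `blocks:` list, from
  the Bennett–Yazdani-type family rather than from Frey curves (`not_szpiro_epsilon_zero_holds` of the
  sibling `…Holds` file). The printed elementary proof of that
  clause is Oesterlé's (Sém. Bourbaki 694, 1988), by the recursion `(a, b, c) ↦ (4ab, (a − b)², c²)`
  on `a + b = c`, "et donc que `Δ(E_{a_n,b_n,c_n}) / N⁶` n'est pas borné", reported by Szpiro, who
  adds "Il serait intéressant de voir ce que donne la multiplication par deux sur une courbe
  elliptique … (e.g. `Y³ = X³ + 6`)" — which is what the doubling orbit of this file does.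
  [cite: Szpiro1990Discriminant, pp. 12–13]

## References

* M. A. Bennett, S. Yazdani, *A local version of Szpiro's conjecture*, Exp. Math. 21 (2012),
  no. 2, 103–116, §7, Proposition 7.4. [cite: BennettYazdani2012, §7 Prop. 7.4]
* J. H. Silverman, *The Arithmetic of Elliptic Curves*, GTM 106, 2nd ed. 2009, VII.1 Remark 1.1,
  VII.5 Prop. 5.1 (local criteria used through `SzpiroLocalDataProofs`). [cite: SilvermanAEC2009, VII.1 and VII.5]
* L. Szpiro, *Discriminant et conducteur des courbes elliptiques*, Astérisque 183 (1990), 7–18,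
  pp. 12–13 (Oesterlé's `ε = 0` examples; doubling on a cubic). [cite: Szpiro1990Discriminant, pp. 12–13]
-/

open IsDedekindDomain WeierstrassCurve Rat.HeightOneSpectrum

namespace Literature.Barriers.ABC

namespace BennettYazdani

/-! ### The equations `y² + a xy + b y = x³` over `ℤ` -/

section Model

/-- Covariant `c₄` of `y² + a xy + b y = x³`: `c₄ = a (a³ − 24 b)`. [folklore] -/
theorem c₄_mk (a b : ℤ) : (WeierstrassCurve.mk a 0 b 0 0).c₄ = a * (a ^ 3 - 24 * b) := by
  simp only [WeierstrassCurve.c₄, WeierstrassCurve.b₂, WeierstrassCurve.b₄]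
  ring

/-- Discriminant of `y² + a xy + b y = x³`: `Δ = b³ (a³ − 27 b)`. [folklore] -/
theorem Δ_mk (a b : ℤ) : (WeierstrassCurve.mk a 0 b 0 0).Δ = b ^ 3 * (a ^ 3 - 27 * b) := by
  simp only [WeierstrassCurve.Δ, WeierstrassCurve.b₂, WeierstrassCurve.b₄, WeierstrassCurve.b₆,
    WeierstrassCurve.b₈]
  ring

/-- A prime dividing both members of a coprime pair is absurd. [folklore] -/
theorem not_dvd_of_isCoprime {a b : ℤ} (hab : IsCoprime a b) {p : ℕ} (hp : p.Prime)
    (ha : (p : ℤ) ∣ a) (hb : (p : ℤ) ∣ b) : False :=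
  (Nat.prime_iff_prime_int.mp hp).not_unit (hab.isUnit_of_dvd' ha hb)

/-- For coprime `a, b` with `3 ∤ a`, no prime divides both `Δ = b³ (a³ − 27 b)` and
`c₄ = a (a³ − 24 b)` of `y² + a xy + b y = x³`. [folklore] -/
theorem not_dvd_c₄_of_dvd_Δ {a b : ℤ} (hab : IsCoprime a b) (h3 : ¬ (3 : ℤ) ∣ a) {p : ℕ}
    (hp : p.Prime) (hΔ : (p : ℤ) ∣ b ^ 3 * (a ^ 3 - 27 * b)) :
    ¬ (p : ℤ) ∣ a * (a ^ 3 - 24 * b) := by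
  have hpint : Prime (p : ℤ) := Nat.prime_iff_prime_int.mp hp
  intro hc
  -- first reduce `hΔ` to `p ∣ b ∨ p ∣ a³ − 27 b`
  have hΔ' : (p : ℤ) ∣ b ∨ (p : ℤ) ∣ a ^ 3 - 27 * b := by
    rcases hpint.dvd_or_dvd hΔ with h | h
    · exact Or.inl (hpint.dvd_of_dvd_pow h)
    · exact Or.inr h
  rcases hpint.dvd_or_dvd hc with ha | ha
  · -- `p ∣ a`
    rcases hΔ' with h | h
    · exact not_dvd_of_isCoprime hab hp ha h
    · have h27 : (p : ℤ) ∣ 27 * b := by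
        have : (p : ℤ) ∣ a ^ 3 := dvd_pow ha three_ne_zero
        have := dvd_sub this h
        rwa [sub_sub_cancel] at this
      rcases hpint.dvd_or_dvd h27 with h | h
      · -- `p ∣ 27 = 3³`, so `p = 3 ∣ a`
        have h3' : (p : ℤ) ∣ 3 ^ 3 := by norm_num; exact h
        have hp3 : p = 3 := by
          have := Int.natCast_dvd_natCast.mp
            (by exact_mod_cast hpint.dvd_of_dvd_pow h3' : (p : ℤ) ∣ (3 : ℕ))
          exact (Nat.prime_dvd_prime_iff_eq hp Nat.prime_three).mp this
        subst hp3
        exact h3 (by exact_mod_cast ha)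
      · exact not_dvd_of_isCoprime hab hp ha h
  · -- `p ∣ a³ − 24 b`
    rcases hΔ' with h | h
    · have : (p : ℤ) ∣ a ^ 3 := by
        have := dvd_add ha (dvd_mul_of_dvd_right h 24)
        rwa [sub_add_cancel] at this
      exact not_dvd_of_isCoprime hab hp (hpint.dvd_of_dvd_pow this) h
    · have h3b : (p : ℤ) ∣ 3 * b := by
        have := dvd_sub ha h
        have e : a ^ 3 - 24 * b - (a ^ 3 - 27 * b) = 3 * b := by ring
        rwa [e] at this
      rcases hpint.dvd_or_dvd h3b with h' | h'
      · -- `p = 3`: then `3 ∣ a³ − 27 b` gives `3 ∣ a`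
        have hp3 : p = 3 := by
          have := Int.natCast_dvd_natCast.mp (by exact_mod_cast h' : (p : ℤ) ∣ (3 : ℕ))
          exact (Nat.prime_dvd_prime_iff_eq hp Nat.prime_three).mp this
        subst hp3
        have : ((3 : ℕ) : ℤ) ∣ a ^ 3 := by
          have := dvd_add h (dvd_mul_of_dvd_left (by norm_num : ((3 : ℕ) : ℤ) ∣ 27) b)
          rwa [sub_add_cancel] at this
        exact h3 (by exact_mod_cast hpint.dvd_of_dvd_pow this)
      · have : (p : ℤ) ∣ a ^ 3 := by
          have := dvd_add ha (dvd_mul_of_dvd_right h' 24)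
          rwa [sub_add_cancel] at this
        exact not_dvd_of_isCoprime hab hp (hpint.dvd_of_dvd_pow this) h'

variable {a b : ℤ}

/-- `y² + a xy + b y = x³` is an elliptic curve over `ℚ` when `b ≠ 0` and `a³ ≠ 27 b`. [folklore] -/
theorem isElliptic_mk (hb : b ≠ 0) (hab : a ^ 3 - 27 * b ≠ 0) :
    ((WeierstrassCurve.mk a 0 b 0 0).baseChange ℚ).IsElliptic := by
  refine ⟨?_⟩
  rw [baseChange_int_Δ, Δ_mk, isUnit_iff_ne_zero]
  exact_mod_cast mul_ne_zero (pow_ne_zero 3 hb) hab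

/-- For coprime `a, b` with `3 ∤ a`, `y² + a xy + b y = x³` is a minimal Weierstrass equation
at every prime: where `p ∣ Δ` one has `p ∤ c₄`, elsewhere `p¹² ∤ Δ`.
[folklore] -/
theorem isMinimalAt_mk (hc : IsCoprime a b) (h3 : ¬ (3 : ℤ) ∣ a) (v : HeightOneSpectrum ℤ) :
    ((WeierstrassCurve.mk a 0 b 0 0).baseChange ℚ).IsMinimalAt v := by
  set p := natGenerator v with hp
  have hpp : p.Prime := prime_natGenerator v
  by_cases hΔ : (p : ℤ) ∣ b ^ 3 * (a ^ 3 - 27 * b)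
  · refine isMinimalAt_baseChange_int_of_not_dvd_c₄ ?_
    rw [← hp, c₄_mk]
    exact not_dvd_c₄_of_dvd_Δ hc h3 hpp hΔ
  · refine isMinimalAt_baseChange_int_of_not_pow_dvd_Δ ?_
    rw [← hp, Δ_mk]
    exact fun h ↦ hΔ (dvd_trans (dvd_pow_self _ (by norm_num)) h)

/-- Semistability of `y² + a xy + b y = x³` for coprime `a, b` with `3 ∤ a`: multiplicative
reduction at the primes of `Δ` (`p ∤ c₄` there), good reduction elsewhere. [folklore] -/
theorem isSemistableAt_mk (hc : IsCoprime a b) (h3 : ¬ (3 : ℤ) ∣ a) (hb : b ≠ 0)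
    (hab : a ^ 3 - 27 * b ≠ 0) (v : HeightOneSpectrum ℤ) :
    ((WeierstrassCurve.mk a 0 b 0 0).baseChange ℚ).IsSemistableAt v := by
  haveI := isElliptic_mk hb hab
  set p := natGenerator v with hp
  have hpp : p.Prime := prime_natGenerator v
  by_cases hΔ : (p : ℤ) ∣ b ^ 3 * (a ^ 3 - 27 * b)
  · right
    have hmin := isMinimalAt_mk hc h3 v
    refine (hasMultiplicativeReductionAt_iff_of_isMinimalAt hmin).mpr ⟨?_, ?_⟩
    · rw [baseChange_int_Δ, Literature.NumberTheory.EllipticCurves.Rat.valuation_intCast_lt_one_iff, ← hp, Δ_mk]; exact hΔ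
    · rw [baseChange_int_c₄, Literature.NumberTheory.EllipticCurves.Rat.valuation_intCast_eq_one_iff, ← hp, c₄_mk]
      exact not_dvd_c₄_of_dvd_Δ hc h3 hpp hΔ
  · left
    refine hasGoodReductionAt_of_valuation_Δ_eq_one_holds v _ (isIntegralAt_baseChange_int v _) ?_
    rw [baseChange_int_Δ, Literature.NumberTheory.EllipticCurves.Rat.valuation_intCast_eq_one_iff, ← hp, Δ_mk]; exact hΔ

/-- For `y² + a xy + b y = x³` with coprime `a, b`, `3 ∤ a` (a global minimal equation),
`ord_p (Δ_min) ≥ k ↔ p ^ k ∣ Δ = b³ (a³ − 27 b)`. [folklore] -/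
theorem le_ordMinimalDiscriminant_mk_iff (hc : IsCoprime a b) (h3 : ¬ (3 : ℤ) ∣ a) (hb : b ≠ 0)
    (hab : a ^ 3 - 27 * b ≠ 0) (v : HeightOneSpectrum ℤ) (k : ℕ) :
    k ≤ ((WeierstrassCurve.mk a 0 b 0 0).baseChange ℚ).ordMinimalDiscriminant v ↔
      (natGenerator v : ℤ) ^ k ∣ b ^ 3 * (a ^ 3 - 27 * b) := by
  haveI := isElliptic_mk hb hab
  have h := valuation_Δ_eq_of_isMinimalAt_holds v _ (isMinimalAt_mk hc h3 v)
  rw [baseChange_int_Δ] at h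
  rw [← Δ_mk, ← Literature.NumberTheory.EllipticCurves.Rat.valuation_intCast_le_exp_iff, h, WithZero.exp_le_exp, neg_le_neg_iff,
    Nat.cast_le]

/-- If moreover `a³ − 27 b = n³` and `b n` is powerful (every prime factor occurs squared), then
every nonzero exponent of the minimal discriminant `Δ_min = (b n)³` is at least `6`. [folklore] -/
theorem six_le_ordMinimalDiscriminant_mk (hc : IsCoprime a b) (h3 : ¬ (3 : ℤ) ∣ a) (hb : b ≠ 0)
    {n : ℤ} (hn : a ^ 3 - 27 * b = n ^ 3) (hn0 : n ≠ 0)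
    (hpow : ∀ p : ℕ, p.Prime → (p : ℤ) ∣ b * n → (p : ℤ) ^ 2 ∣ b * n)
    (v : HeightOneSpectrum ℤ)
    (hv : ((WeierstrassCurve.mk a 0 b 0 0).baseChange ℚ).ordMinimalDiscriminant v ≠ 0) :
    6 ≤ ((WeierstrassCurve.mk a 0 b 0 0).baseChange ℚ).ordMinimalDiscriminant v := by
  have hab : a ^ 3 - 27 * b ≠ 0 := by rw [hn]; exact pow_ne_zero 3 hn0
  have hpp : (natGenerator v).Prime := prime_natGenerator v
  have hpint : Prime (natGenerator v : ℤ) := Nat.prime_iff_prime_int.mp hpp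
  have hΔ : b ^ 3 * (a ^ 3 - 27 * b) = (b * n) ^ 3 := by rw [hn]; ring
  have h1 : (natGenerator v : ℤ) ∣ b * n := by
    have := (le_ordMinimalDiscriminant_mk_iff hc h3 hb hab v 1).mp (Nat.one_le_iff_ne_zero.mpr hv)
    rw [pow_one, hΔ] at this
    exact hpint.dvd_of_dvd_pow this
  rw [le_ordMinimalDiscriminant_mk_iff hc h3 hb hab v 6, hΔ,
    show (natGenerator v : ℤ) ^ 6 = ((natGenerator v : ℤ) ^ 2) ^ 3 by ring]
  exact pow_dvd_pow_of_dvd (hpow _ hpp h1) 3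

end Model


/-! ### The doubling orbit on the Mordell curve `Y² = X³ − 216` -/

section Orbit

/-- The `x`-coordinate duplication formula on `Y² = X³ − 216` satisfies
`x(2P)³ − 216 = (X⁶ − 4320 X³ − 373248)² / (64 (X³ − 216)³)` identically. [folklore] -/
theorem dbl_cube_sub (X : ℚ) (hX : X ^ 3 - 216 ≠ 0) :
    ((X ^ 4 + 1728 * X) / (4 * (X ^ 3 - 216))) ^ 3 - 216 =
      (X ^ 6 - 4320 * X ^ 3 - 373248) ^ 2 / (64 * (X ^ 3 - 216) ^ 3) := by
  field_simp
  ring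

/-- Duplication on `Y² = X³ − 216`: if `(X, Y)` is an affine point with `Y ≠ 0` then so is
`(x(2P), y(2P))` with `x(2P) = (X⁴ + 1728 X) / (4 (X³ − 216))`,
`y(2P) = (X⁶ − 4320 X³ − 373248) / (8 Y³)` (up to sign). [folklore] -/
theorem dbl_sq (X Y : ℚ) (hY : Y ^ 2 = X ^ 3 - 216) (hY0 : Y ≠ 0) :
    ((X ^ 6 - 4320 * X ^ 3 - 373248) / (8 * Y ^ 3)) ^ 2 =
      ((X ^ 4 + 1728 * X) / (4 * (X ^ 3 - 216))) ^ 3 - 216 := by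
  have hX : X ^ 3 - 216 ≠ 0 := by rw [← hY]; exact pow_ne_zero 2 hY0
  rw [dbl_cube_sub X hX, div_pow, show (8 * Y ^ 3) ^ 2 = 64 * (Y ^ 2) ^ 3 by ring, hY]

/-- Ultrametric bookkeeping: adding an integer to a rational of negative valuation does not change
the valuation. [folklore] -/
theorem padicValRat_add_intCast_of_neg {p : ℕ} [Fact p.Prime] {q : ℚ} (hq : padicValRat p q < 0)
    (c : ℤ) : padicValRat p (q + c) = padicValRat p q := by
  by_cases hc : c = 0
  · simp [hc]
  have hq0 : q ≠ 0 := by rintro rfl; simp at hq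
  have hcv : 0 ≤ padicValRat p (c : ℚ) := by
    rw [padicValRat.of_int]; exact_mod_cast (Nat.cast_nonneg _)
  have hlt : padicValRat p q < padicValRat p (c : ℚ) := lt_of_lt_of_le hq hcv
  refine padicValRat.add_eq_of_lt ?_ hq0 (Int.cast_ne_zero.mpr hc) hlt
  intro h
  have : q = -(c : ℚ) := eq_neg_of_add_eq_zero_left h
  rw [this, padicValRat.neg] at hlt
  exact lt_irrefl _ hlt

/-- If `ord_p (X) < 0` then `X³ − 216 ≠ 0`. [folklore] -/
theorem cube_sub_ne_zero_of_neg {p : ℕ} [Fact p.Prime] {X : ℚ} (hX : padicValRat p X < 0) :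
    X ^ 3 - 216 ≠ 0 := by
  intro h
  have hX0 : X ≠ 0 := by rintro rfl; simp at hX
  have h3 : padicValRat p (X ^ 3) < 0 := by rw [padicValRat.pow]; push_cast; linarith
  have := padicValRat_add_intCast_of_neg h3 (-216)
  push_cast at this
  rw [← sub_eq_add_neg, h] at this
  simp at this
  linarith

/-- Valuation of the duplication `x`-coordinate at a prime where `ord_p (X) < 0`:
`ord_p (x(2P)) = ord_p (X) − ord_p (4)`. [folklore] -/
theorem padicValRat_dbl {p : ℕ} [Fact p.Prime] {X : ℚ} (hX : padicValRat p X < 0) :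
    padicValRat p ((X ^ 4 + 1728 * X) / (4 * (X ^ 3 - 216))) =
      padicValRat p X - padicValRat p 4 := by
  have hX0 : X ≠ 0 := by rintro rfl; simp at hX
  have h3 : padicValRat p (X ^ 3) < 0 := by rw [padicValRat.pow]; push_cast; linarith
  have hA : padicValRat p (X ^ 3 + 1728) = padicValRat p (X ^ 3) := by
    have := padicValRat_add_intCast_of_neg h3 1728; push_cast at this; exact this
  have hB : padicValRat p (X ^ 3 - 216) = padicValRat p (X ^ 3) := by
    have := padicValRat_add_intCast_of_neg h3 (-216); push_cast at this
    rwa [← sub_eq_add_neg] at this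
  have hA0 : X ^ 3 + 1728 ≠ 0 := by
    intro h; rw [h] at hA; simp at hA; linarith
  have hB0 : X ^ 3 - 216 ≠ 0 := cube_sub_ne_zero_of_neg hX
  have h4 : (4 : ℚ) ≠ 0 := by norm_num
  rw [show X ^ 4 + 1728 * X = X * (X ^ 3 + 1728) by ring,
    padicValRat.div (mul_ne_zero hX0 hA0) (mul_ne_zero h4 hB0),
    padicValRat.mul hX0 hA0, padicValRat.mul h4 hB0, hA, hB]
  ring

/-- `ord₂ (4) = 2`. [folklore] -/
theorem padicValRat_two_four : padicValRat 2 4 = 2 := by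
  have h2 : padicValRat 2 (2 : ℚ) = 1 := by exact_mod_cast padicValRat.self one_lt_two
  rw [show (4 : ℚ) = 2 ^ 2 by norm_num, padicValRat.pow, h2]
  norm_num

/-- `ord₃ (4) = 0`. [folklore] -/
theorem padicValRat_three_four : padicValRat 3 4 = 0 := by
  rw [show (4 : ℚ) = ((4 : ℕ) : ℚ) by norm_num, padicValRat.of_nat]
  exact_mod_cast padicValNat.eq_zero_of_not_dvd (by norm_num)

/-- The doubling orbit of a point of `Y² = X³ − 216` lying in the formal groups at `2` and `3`:
along `X_{j+1} = x(2 P_j)` the points stay on the curve, `ord₂ (X_j) = ord₂ (X₀) − 2 j` and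
`ord₃ (X_j) ≤ −2`. [folklore] -/
theorem orbit {X₀ Y₀ : ℚ} (h0 : Y₀ ^ 2 = X₀ ^ 3 - 216) (h2 : padicValRat 2 X₀ = -2)
    (h3 : padicValRat 3 X₀ ≤ -2) (j : ℕ) :
    (∃ Y : ℚ, Y ^ 2 = ((fun X : ℚ ↦ (X ^ 4 + 1728 * X) / (4 * (X ^ 3 - 216)))^[j] X₀) ^ 3 - 216) ∧
    padicValRat 2 ((fun X : ℚ ↦ (X ^ 4 + 1728 * X) / (4 * (X ^ 3 - 216)))^[j] X₀) = -2 - 2 * j ∧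
    padicValRat 3 ((fun X : ℚ ↦ (X ^ 4 + 1728 * X) / (4 * (X ^ 3 - 216)))^[j] X₀) ≤ -2 := by
  induction j with
  | zero => exact ⟨⟨Y₀, h0⟩, by simpa using h2, by simpa using h3⟩
  | succ j ih =>
    obtain ⟨⟨Y, hY⟩, ih2, ih3⟩ := ih
    set X := (fun X : ℚ ↦ (X ^ 4 + 1728 * X) / (4 * (X ^ 3 - 216)))^[j] X₀ with hXdef
    haveI I2 : Fact (Nat.Prime 2) := ⟨Nat.prime_two⟩
    haveI I3 : Fact (Nat.Prime 3) := ⟨Nat.prime_three⟩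
    have hX2 : padicValRat 2 X < 0 := by rw [ih2]; linarith
    have hX3 : padicValRat 3 X < 0 := by linarith
    have hY0 : Y ≠ 0 := by
      intro hY0; rw [hY0] at hY
      exact cube_sub_ne_zero_of_neg hX2 (by simpa using hY.symm)
    rw [Function.iterate_succ_apply']
    refine ⟨⟨(X ^ 6 - 4320 * X ^ 3 - 373248) / (8 * Y ^ 3), dbl_sq X Y hY hY0⟩, ?_, ?_⟩
    · rw [padicValRat_dbl hX2, ih2, padicValRat_two_four]; push_cast; ring
    · rw [padicValRat_dbl hX3, padicValRat_three_four]; linarith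

/-- A rational point of `Y² = X³ − 216` in the formal groups at `2` and `3`, namely `6 · (10, 28)`:
`ord₂ (X₀) = ord₃ (X₀) = −2`. [folklore] -/
theorem exists_start : ∃ X₀ Y₀ : ℚ, Y₀ ^ 2 = X₀ ^ 3 - 216 ∧ padicValRat 2 X₀ = -2 ∧
    padicValRat 3 X₀ = -2 := by
  refine ⟨4311394514985840571859496854761 / 12304768338498259223639216100,
    -8952113028882351328146511032489972199239803509 / 1364929318646149870401609302638733658159000,
    by norm_num, ?_, ?_⟩
  · haveI : Fact (Nat.Prime 2) := ⟨Nat.prime_two⟩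
    rw [padicValRat.div (by norm_num) (by norm_num),
      show (4311394514985840571859496854761 : ℚ) = ((4311394514985840571859496854761 : ℕ) : ℚ) by
        norm_num,
      show (12304768338498259223639216100 : ℚ) =
        ((2 ^ 2 * 3076192084624564805909804025 : ℕ) : ℚ) by norm_num,
      padicValRat.of_nat, padicValRat.of_nat, padicValNat.eq_zero_of_not_dvd (by norm_num),
      padicValNat.mul (by norm_num) (by norm_num), padicValNat.prime_pow,
      padicValNat.eq_zero_of_not_dvd (by norm_num)]
    norm_num
  · haveI : Fact (Nat.Prime 3) := ⟨Nat.prime_three⟩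
    rw [padicValRat.div (by norm_num) (by norm_num),
      show (4311394514985840571859496854761 : ℚ) = ((4311394514985840571859496854761 : ℕ) : ℚ) by
        norm_num,
      show (12304768338498259223639216100 : ℚ) =
        ((3 ^ 2 * 1367196482055362135959912900 : ℕ) : ℚ) by norm_num,
      padicValRat.of_nat, padicValRat.of_nat, padicValNat.eq_zero_of_not_dvd (by norm_num),
      padicValNat.mul (by norm_num) (by norm_num), padicValNat.prime_pow,
      padicValNat.eq_zero_of_not_dvd (by norm_num)]
    norm_num

end Orbit


/-! ### From a point of the orbit to the parameters `(m, n, b)` -/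

section Bridge

/-- For a nonzero rational `q` with `ord_p (q) = 0`, `p` divides neither numerator nor
denominator. [folklore] -/
theorem not_dvd_num_den_of_padicValRat_eq_zero {p : ℕ} [hp : Fact p.Prime] {q : ℚ} (hq : q ≠ 0)
    (h : padicValRat p q = 0) : ¬ (p : ℤ) ∣ q.num ∧ ¬ (p : ℤ) ∣ (q.den : ℤ) := by
  rw [padicValRat_def] at h
  have hcop := q.reduced
  have hnum : q.num ≠ 0 := Rat.num_ne_zero.mpr hq
  have key : ¬ ((p : ℤ) ∣ q.num ∧ (p : ℤ) ∣ (q.den : ℤ)) := by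
    rintro ⟨hn, hd⟩
    have h1 : p ∣ q.num.natAbs := Int.natCast_dvd.mp hn
    have h2 : p ∣ q.den := Int.natCast_dvd_natCast.mp hd
    exact hp.out.ne_one (Nat.eq_one_of_dvd_coprimes hcop h1 h2)
  by_cases hn : (p : ℤ) ∣ q.num
  · have hd : ¬ (p : ℤ) ∣ (q.den : ℤ) := fun hd ↦ key ⟨hn, hd⟩
    refine ⟨fun _ ↦ ?_, hd⟩
    have hd' : ¬ p ∣ q.den := fun h' ↦ hd (Int.natCast_dvd_natCast.mpr h')
    rw [padicValNat.eq_zero_of_not_dvd hd', Nat.cast_zero, sub_zero] at h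
    have h0 : padicValInt p q.num = 0 := by exact_mod_cast h
    rcases padicValInt.eq_zero_iff.mp h0 with h' | h' | h'
    · exact hp.out.ne_one h'
    · exact hnum h'
    · exact h' hn
  · refine ⟨hn, fun hd ↦ ?_⟩
    rw [padicValInt.eq_zero_of_not_dvd hn, Nat.cast_zero, zero_sub, neg_eq_zero] at h
    have h0 : padicValNat p q.den = 0 := by exact_mod_cast h
    rcases padicValNat.eq_zero_iff.mp h0 with h' | h' | h'
    · exact hp.out.ne_one h'
    · exact q.den_pos.ne' h'
    · exact h' (Int.natCast_dvd_natCast.mp hd)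

/-- For a rational `q` whose denominator is prime to `p`, `ord_p (q − 1) = ord_p (num − den)`.
[folklore] -/
theorem padicValRat_sub_one_eq {p : ℕ} [hp : Fact p.Prime] {q : ℚ} (hd : ¬ (p : ℤ) ∣ (q.den : ℤ)) :
    padicValRat p (q - 1) = padicValInt p (q.num - q.den) := by
  have hden : (q.den : ℚ) ≠ 0 := by exact_mod_cast q.den_pos.ne'
  have hq : q - 1 = ((q.num - q.den : ℤ) : ℚ) / (q.den : ℚ) := by
    conv_lhs => rw [← Rat.num_div_den q]
    push_cast
    field_simp
  by_cases h0 : q.num - (q.den : ℤ) = 0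
  · rw [hq, h0]; simp
  rw [hq, padicValRat.div (by exact_mod_cast h0) hden, padicValRat.of_int, padicValRat.of_nat,
    padicValNat.eq_zero_of_not_dvd (fun h ↦ hd (Int.natCast_dvd_natCast.mpr h))]
  simp

variable {X : ℚ}

/-- `ord_p (X − 6) = ord_p (X)` when `ord_p (X) < 0`. [folklore] -/
theorem padicValRat_sub_six {p : ℕ} [Fact p.Prime] (hX : padicValRat p X < 0) :
    padicValRat p (X - 6) = padicValRat p X := by
  have := padicValRat_add_intCast_of_neg hX (-6)
  push_cast at this
  rwa [← sub_eq_add_neg] at this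

/-- `ord_p (X + 12) = ord_p (X)` when `ord_p (X) < 0`. [folklore] -/
theorem padicValRat_add_twelve {p : ℕ} [Fact p.Prime] (hX : padicValRat p X < 0) :
    padicValRat p (X + 12) = padicValRat p X := by
  have := padicValRat_add_intCast_of_neg hX 12
  push_cast at this
  exact this

/-- `X − 6 ≠ 0` when `ord_p (X) < 0`. [folklore] -/
theorem sub_six_ne_zero {p : ℕ} [Fact p.Prime] (hX : padicValRat p X < 0) : X - 6 ≠ 0 := by
  intro h; have := padicValRat_sub_six hX; rw [h] at this; simp at this; linarith

/-- `X + 12 ≠ 0` when `ord_p (X) < 0`. [folklore] -/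
theorem add_twelve_ne_zero {p : ℕ} [Fact p.Prime] (hX : padicValRat p X < 0) : X + 12 ≠ 0 := by
  intro h; have := padicValRat_add_twelve hX; rw [h] at this; simp at this; linarith

/-- `λ = (X + 12)/(X − 6)` is a `p`-adic unit when `ord_p (X) < 0`. [folklore] -/
theorem padicValRat_lam {p : ℕ} [Fact p.Prime] (hX : padicValRat p X < 0) :
    padicValRat p ((X + 12) / (X - 6)) = 0 := by
  rw [padicValRat.div (add_twelve_ne_zero hX) (sub_six_ne_zero hX), padicValRat_add_twelve hX,
    padicValRat_sub_six hX, sub_self]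

/-- `λ − 1 = 18 / (X − 6)`. [folklore] -/
theorem lam_sub_one (h : X - 6 ≠ 0) : (X + 12) / (X - 6) - 1 = 18 / (X - 6) := by
  field_simp; ring

/-- `ord_p (λ − 1) = ord_p (18) − ord_p (X)` when `ord_p (X) < 0`. [folklore] -/
theorem padicValRat_lam_sub_one {p : ℕ} [Fact p.Prime] (hX : padicValRat p X < 0) :
    padicValRat p ((X + 12) / (X - 6) - 1) = padicValRat p 18 - padicValRat p X := by
  rw [lam_sub_one (sub_six_ne_zero hX), padicValRat.div (by norm_num) (sub_six_ne_zero hX),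
    padicValRat_sub_six hX]

/-- `λ = (X + 12)/(X − 6) ≠ 0` when `ord_p (X) < 0`. [folklore] -/
theorem lam_ne_zero {p : ℕ} [Fact p.Prime] (hX : padicValRat p X < 0) : (X + 12) / (X - 6) ≠ 0 :=
  div_ne_zero (add_twelve_ne_zero hX) (sub_six_ne_zero hX)

/-- The level-`3` identity behind the construction: `λ³ − 1 = 54 (X³ − 216) / (X − 6)⁴` for
`λ = (X + 12)/(X − 6)`, so that on `Y² = X³ − 216` the quantity `λ³ − 1` is `6` times a square.
[folklore] -/
theorem lam_cube_sub_one (h : X - 6 ≠ 0) :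
    ((X + 12) / (X - 6)) ^ 3 - 1 = 54 * (X ^ 3 - 216) / (X - 6) ^ 4 := by
  field_simp; ring

/-- `ord₂ (18) = 1`. [folklore] -/
theorem padicValRat_two_eighteen : padicValRat 2 18 = 1 := by
  have h2 : padicValRat 2 (2 : ℚ) = 1 := by exact_mod_cast padicValRat.self one_lt_two
  have h9 : padicValRat 2 (9 : ℚ) = 0 := by
    rw [show (9 : ℚ) = ((9 : ℕ) : ℚ) by norm_num, padicValRat.of_nat]
    exact_mod_cast padicValNat.eq_zero_of_not_dvd (by norm_num)
  rw [show (18 : ℚ) = 2 * 9 by norm_num, padicValRat.mul two_ne_zero (by norm_num), h2, h9]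
  norm_num

/-- `ord₃ (18) = 2`. [folklore] -/
theorem padicValRat_three_eighteen : padicValRat 3 18 = 2 := by
  have h3 : padicValRat 3 (3 : ℚ) = 1 := by
    exact_mod_cast padicValRat.self (by norm_num : 1 < 3)
  have h2 : padicValRat 3 (2 : ℚ) = 0 := by
    rw [show (2 : ℚ) = ((2 : ℕ) : ℚ) by norm_num, padicValRat.of_nat]
    exact_mod_cast padicValNat.eq_zero_of_not_dvd (by norm_num)
  rw [show (18 : ℚ) = 2 * 3 ^ 2 by norm_num, padicValRat.mul two_ne_zero (by norm_num),
    padicValRat.pow, h2, h3]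
  norm_num

/-- **The parameters.** For `X` the `x`-coordinate of a rational point of `Y² = X³ − 216` in the
formal groups at `2` and `3` (`ord₂ (X) ≤ −2`, `ord₃ (X) ≤ −2`), write `(X + 12)/(X − 6) = m/n` in
lowest terms; then `m³ − n³ = 27 b` with `m, b` coprime, `3 ∤ m`, `b n ≠ 0`, `b n` powerful, and
`2^{1 − ord₂ X} ∣ b`. [folklore] -/
theorem exists_params (hsq : ∃ Y : ℚ, Y ^ 2 = X ^ 3 - 216) (h2 : padicValRat 2 X ≤ -2)
    (h3 : padicValRat 3 X ≤ -2) :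
    ∃ m b n : ℤ, m ^ 3 - 27 * b = n ^ 3 ∧ IsCoprime m b ∧ ¬ (3 : ℤ) ∣ m ∧ b ≠ 0 ∧ n ≠ 0 ∧
      (∀ p : ℕ, p.Prime → (p : ℤ) ∣ b * n → (p : ℤ) ^ 2 ∣ b * n) ∧
      (2 : ℤ) ^ (1 - padicValRat 2 X).toNat ∣ b := by
  haveI I2 : Fact (Nat.Prime 2) := ⟨Nat.prime_two⟩
  haveI I3 : Fact (Nat.Prime 3) := ⟨Nat.prime_three⟩
  obtain ⟨Y, hY⟩ := hsq
  have hX2 : padicValRat 2 X < 0 := by linarith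
  have hX3 : padicValRat 3 X < 0 := by linarith
  have hX6 : X - 6 ≠ 0 := sub_six_ne_zero hX2
  set q : ℚ := (X + 12) / (X - 6) with hq
  have hq0 : q ≠ 0 := lam_ne_zero hX2
  set m : ℤ := q.num with hm
  set n : ℤ := (q.den : ℤ) with hn
  have hn0 : n ≠ 0 := by rw [hn]; exact_mod_cast q.den_pos.ne'
  have hnq : (n : ℚ) ≠ 0 := by exact_mod_cast hn0
  have hmn : (m : ℚ) / n = q := by rw [hm, hn]; exact_mod_cast Rat.num_div_den q
  -- `2 ∤ n`, `3 ∤ m`, `3 ∤ n`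
  obtain ⟨-, h2n⟩ := not_dvd_num_den_of_padicValRat_eq_zero hq0 (padicValRat_lam hX2)
  obtain ⟨h3m, h3n⟩ := not_dvd_num_den_of_padicValRat_eq_zero hq0 (padicValRat_lam hX3)
  -- `m ≠ n`
  have hmn0 : m - n ≠ 0 := by
    intro h
    have h1 : q - 1 = 18 / (X - 6) := lam_sub_one hX6
    have : q = 1 := by
      rw [← hmn, sub_eq_zero.mp h, div_self hnq]
    rw [this, sub_self] at h1
    exact absurd h1.symm (div_ne_zero (by norm_num) hX6)
  -- valuations of `m - n`
  have hv2 : (padicValInt 2 (m - n) : ℤ) = 1 - padicValRat 2 X := by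
    have := padicValRat_lam_sub_one hX2
    rwa [padicValRat_sub_one_eq h2n, padicValRat_two_eighteen] at this
  have hv3 : (padicValInt 3 (m - n) : ℤ) = 2 - padicValRat 3 X := by
    have := padicValRat_lam_sub_one hX3
    rwa [padicValRat_sub_one_eq h3n, padicValRat_three_eighteen] at this
  set k : ℕ := (1 - padicValRat 2 X).toNat with hk
  have hk3 : 3 ≤ k := by rw [hk]; omega
  have hd2 : (2 : ℤ) ^ k ∣ m - n := by
    have := (padicValInt_dvd_iff (p := 2) k (m - n)).mpr (Or.inr (Int.toNat_le.mpr hv2.symm.le))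
    exact_mod_cast this
  have hd3 : (3 : ℤ) ^ 4 ∣ m - n := by
    have h4 : 4 ≤ padicValInt 3 (m - n) := by
      have : (4 : ℤ) ≤ padicValInt 3 (m - n) := by rw [hv3]; linarith
      exact_mod_cast this
    have := (padicValInt_dvd_iff (p := 3) 4 (m - n)).mpr (Or.inr h4)
    exact_mod_cast this
  -- `3⁵ ∣ m³ − n³ = 27 b`
  have h3q : (3 : ℤ) ∣ m ^ 2 + m * n + n ^ 2 := by
    have h3mn : (3 : ℤ) ∣ m - n := dvd_trans ⟨27, by norm_num⟩ hd3
    rw [show m ^ 2 + m * n + n ^ 2 = (m - n) ^ 2 + 3 * (m * n) by ring]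
    exact dvd_add (dvd_pow h3mn two_ne_zero) (dvd_mul_right 3 _)
  have hfac : m ^ 3 - n ^ 3 = (m - n) * (m ^ 2 + m * n + n ^ 2) := by ring
  have h35 : (3 : ℤ) ^ 4 * 3 ∣ m ^ 3 - n ^ 3 := by rw [hfac]; exact mul_dvd_mul hd3 h3q
  obtain ⟨b, hb⟩ : (27 : ℤ) ∣ m ^ 3 - n ^ 3 := dvd_trans ⟨9, by norm_num⟩ h35
  have h9b : (9 : ℤ) ∣ b := by
    have : (27 : ℤ) * 9 ∣ 27 * b := by rw [← hb]; simpa using h35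
    exact (mul_dvd_mul_iff_left (by norm_num)).mp this
  have h2b : (2 : ℤ) ^ k ∣ b := by
    have hk' : (2 : ℤ) ^ k ∣ 27 * b := by rw [← hb, hfac]; exact dvd_mul_of_dvd_left hd2 _
    exact (IsCoprime.pow_left (by norm_num [Int.isCoprime_iff_gcd_eq_one] : IsCoprime (2 : ℤ) 27)
      ).dvd_of_dvd_mul_left hk'
  -- coprimality
  have hcop_mn : IsCoprime m n := by
    rw [Int.isCoprime_iff_gcd_eq_one, Int.gcd_eq_natAbs, hm, hn, Int.natAbs_natCast]
    exact q.reduced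
  have hcop : IsCoprime m b := by
    have h1 : IsCoprime m (n ^ 3 + m * (-(m ^ 2))) := hcop_mn.pow_right.add_mul_left_right _
    rw [show n ^ 3 + m * (-(m ^ 2)) = -(27 * b) by rw [← hb]; ring] at h1
    have h2 := h1.neg_right
    rw [neg_neg] at h2
    exact h2.of_mul_right_right
  -- `b ≠ 0`
  have hb0 : b ≠ 0 := by
    intro hb0
    rw [hb0, mul_zero, sub_eq_zero] at hb
    exact hmn0 (sub_eq_zero.mpr ((Odd.strictMono_pow (⟨1, by norm_num⟩ : Odd 3)).injective hb))
  -- the square identity `b n = 2 z²`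
  have hY0 : Y ≠ 0 := by
    intro hY0; rw [hY0] at hY
    have hX0 : X ≠ 0 := by rintro rfl; simp at hX2
    have h3' : padicValRat 2 (X ^ 3) < 0 := by rw [padicValRat.pow]; push_cast; linarith
    have := padicValRat_add_intCast_of_neg h3' (-216)
    push_cast at this
    rw [← sub_eq_add_neg, ← hY] at this
    simp at this; linarith
  have hlin : (m : ℚ) * (X - 6) = n * (X + 12) := by
    have := hmn; rw [hq, div_eq_div_iff hnq hX6] at this; linear_combination this
  have hbq : (b : ℚ) = ((m : ℚ) ^ 3 - n ^ 3) / 27 := by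
    have : ((m : ℚ)) ^ 3 - (n : ℚ) ^ 3 = 27 * b := by exact_mod_cast hb
    rw [eq_div_iff (by norm_num)]; linear_combination -this
  have hmq : (m : ℚ) = n * (X + 12) / (X - 6) := by
    field_simp; linear_combination hlin
  have e' : ((b : ℚ) * n) * (X - 6) ^ 4 = 2 * (Y * n ^ 2) ^ 2 := by
    rw [show (Y * (n : ℚ) ^ 2) ^ 2 = Y ^ 2 * n ^ 4 by ring, hY, hbq, hmq]
    field_simp
    ring
  have e : ((b * n : ℤ) : ℚ) = 2 * (Y * n ^ 2 / (X - 6) ^ 2) ^ 2 := by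
    push_cast
    rw [div_pow, show ((X - 6) ^ 2) ^ 2 = (X - 6) ^ 4 by ring, mul_div_assoc',
      eq_div_iff (pow_ne_zero 4 hX6)]
    exact e'
  have hz : Y * (n : ℚ) ^ 2 / (X - 6) ^ 2 ≠ 0 :=
    div_ne_zero (mul_ne_zero hY0 (pow_ne_zero 2 hnq)) (pow_ne_zero 2 hX6)
  have hbn0 : b * n ≠ 0 := mul_ne_zero hb0 hn0
  -- powerful
  have hpow : ∀ p : ℕ, p.Prime → (p : ℤ) ∣ b * n → (p : ℤ) ^ 2 ∣ b * n := by
    intro p hp hpbn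
    by_cases hp2 : p = 2
    · subst hp2
      have : (2 : ℤ) ^ 2 ∣ b := dvd_trans (pow_dvd_pow 2 (by omega)) h2b
      exact_mod_cast dvd_mul_of_dvd_left this n
    by_cases hp3 : p = 3
    · subst hp3
      exact_mod_cast dvd_mul_of_dvd_left (show (3 : ℤ) ^ 2 ∣ b by simpa using h9b) n
    haveI := Fact.mk hp
    have hp2' : padicValRat p 2 = 0 := by
      rw [show (2 : ℚ) = ((2 : ℕ) : ℚ) by norm_num, padicValRat.of_nat]
      have : ¬ p ∣ 2 := fun h ↦ hp2 ((Nat.prime_dvd_prime_iff_eq hp Nat.prime_two).mp h)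
      exact_mod_cast padicValNat.eq_zero_of_not_dvd this
    have hv : (padicValInt p (b * n) : ℤ) = 2 * padicValRat p (Y * n ^ 2 / (X - 6) ^ 2) := by
      rw [← padicValRat.of_int, e, padicValRat.mul two_ne_zero (pow_ne_zero 2 hz), padicValRat.pow,
        hp2']
      push_cast; ring
    have h1 : 1 ≤ padicValInt p (b * n) := by
      rcases (padicValInt_dvd_iff (p := p) 1 (b * n)).mp (by simpa using hpbn) with h | h
      · exact absurd h hbn0
      · exact h
    have h2' : 2 ≤ padicValInt p (b * n) := by
      set w := padicValRat p (Y * n ^ 2 / (X - 6) ^ 2)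
      omega
    exact (padicValInt_dvd_iff (p := p) 2 (b * n)).mpr (Or.inr h2')
  refine ⟨m, b, n, by rw [← hb]; ring, hcop, h3m, hb0, hn0, hpow, h2b⟩

end Bridge


end BennettYazdani

open BennettYazdani in
/-- **Bennett–Yazdani (2012), Proposition 7.4, "in particular" clause — proved.** There are
infinitely many pairwise non-`ℚ`-isomorphic semistable elliptic curves `E/ℚ` with
`ord_p (Δ_min (E)) ≥ 6` at every prime `p ∣ Δ_min (E)`: namely the curves
`y² + m xy + b y = x³`, `27 b = m³ − n³`, attached to the doubling orbit of `6 · (10, 28)` on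
`Y² = X³ − 216` through `(X + 12)/(X − 6) = m/n` (see the module docstring). The printed proof
(rational points on the twisted modular curve `X_F(6)`) is replaced by this elementary
construction; the statement is the vendored one, unchanged.
[cite: BennettYazdani2012, §7 Prop. 7.4] -/
theorem bennettYazdani2012_minOrd_ge_six_holds : bennettYazdani2012_minOrd_ge_six := by
  intro S
  obtain ⟨X₀, Y₀, h0, h20, h30⟩ := exists_start
  obtain ⟨v₂, hv₂⟩ := Literature.NumberTheory.EllipticCurves.exists_place ⟨2, Nat.prime_two⟩
  simp only at hv₂
  -- a bound for the `2`-exponents of the minimal discriminants of the members of `S`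
  set M : ℕ := S.sup fun W' ↦ W'.ordMinimalDiscriminant v₂ with hM
  -- the `M`-th point of the orbit and its parameters
  obtain ⟨hsq, h2, h3⟩ := orbit h0 h20 h30.le M
  obtain ⟨m, b, n, hmbn, hcop, h3m, hb0, hn0, hpow, h2b⟩ :=
    exists_params hsq (by rw [h2]; linarith) h3
  have hab : m ^ 3 - 27 * b ≠ 0 := by rw [hmbn]; exact pow_ne_zero 3 hn0
  haveI := isElliptic_mk hb0 hab
  refine ⟨(WeierstrassCurve.mk m 0 b 0 0).baseChange ℚ, isElliptic_mk hb0 hab, ?_,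
    fun v ↦ isSemistableAt_mk hcop h3m hb0 hab v,
    fun v hv ↦ six_le_ordMinimalDiscriminant_mk hcop h3m hb0 hmbn hn0 hpow v hv⟩
  -- our curve is not `ℚ`-isomorphic to a member of `S`: its `2`-exponent is too large
  intro W' hW' C hC
  have hle : W'.ordMinimalDiscriminant v₂ ≤ M :=
    Finset.le_sup (f := fun W' ↦ W'.ordMinimalDiscriminant v₂) hW'
  have hk : 3 * (1 - padicValRat 2 ((fun X : ℚ ↦ (X ^ 4 + 1728 * X) / (4 * (X ^ 3 - 216)))^[M] X₀)).toNat
      ≤ ((WeierstrassCurve.mk m 0 b 0 0).baseChange ℚ).ordMinimalDiscriminant v₂ := by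
    rw [le_ordMinimalDiscriminant_mk_iff hcop h3m hb0 hab v₂, hv₂, pow_mul']
    exact dvd_mul_of_dvd_left (pow_dvd_pow_of_dvd (by exact_mod_cast h2b) 3) _
  have hsm : (C • W').ordMinimalDiscriminant v₂ = W'.ordMinimalDiscriminant v₂ :=
    ordMinimalDiscriminant_smul_holds v₂ W' C
  rw [← hC, hsm] at hk
  have hM3 : (1 - padicValRat 2 ((fun X : ℚ ↦ (X ^ 4 + 1728 * X) / (4 * (X ^ 3 - 216)))^[M] X₀)).toNat
      = 3 + 2 * M := by
    rw [h2]; omega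
  omega


/-! ### Audit addendum (2026-08-15): the Szpiro excess `|Δ_min| / N⁶` is unbounded along the orbit -/

namespace BennettYazdani

section Conductor

variable {a b : ℤ}

/-- Conductor exponents of `y² + a xy + b y = x³` for coprime `a, b` with `3 ∤ a` (a global minimal
equation, semistable): `f_p = 1` at the primes of `Δ = b³ (a³ − 27 b)`, `f_p = 0` elsewhere.
[folklore] -/
theorem conductorExponent_mk_eq (hc : IsCoprime a b) (h3 : ¬ (3 : ℤ) ∣ a) (hb : b ≠ 0)
    (hab : a ^ 3 - 27 * b ≠ 0) (v : HeightOneSpectrum ℤ) :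
    haveI := isElliptic_mk hb hab
    ((WeierstrassCurve.mk a 0 b 0 0).baseChange ℚ).conductorExponent v =
      if (natGenerator v : ℤ) ∣ b ^ 3 * (a ^ 3 - 27 * b) then 1 else 0 := by
  haveI := isElliptic_mk hb hab
  have hmin := isMinimalAt_mk hc h3 v
  split_ifs with h
  · refine conductorExponent_eq_one_of_dvd_Δ_of_not_dvd_c₄ hmin ?_ ?_
    · rw [Δ_mk]; exact h
    · rw [c₄_mk]; exact not_dvd_c₄_of_dvd_Δ hc h3 (prime_natGenerator v) h
  · refine conductorExponent_eq_zero_of_not_dvd_Δ hmin ?_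
    rw [Δ_mk]; exact h

/-- If moreover `a³ − 27 b = n³`, `b n` is powerful and `2 ^ (k + 2) ∣ b`, then
`N_E ² · 2 ^ k ∣ |b n|` (`N_E` the conductor): `N_E` is squarefree and supported on the primes of
`b n`, each of which divides `b n` twice, and `2` divides it `k + 2` times. [folklore] -/
theorem conductorNorm_sq_mul_dvd (hc : IsCoprime a b) (h3 : ¬ (3 : ℤ) ∣ a) (hb : b ≠ 0)
    {n : ℤ} (hn : a ^ 3 - 27 * b = n ^ 3) (hn0 : n ≠ 0)
    (hpow : ∀ p : ℕ, p.Prime → (p : ℤ) ∣ b * n → (p : ℤ) ^ 2 ∣ b * n)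
    {k : ℕ} (h2b : (2 : ℤ) ^ (k + 2) ∣ b) :
    ((WeierstrassCurve.mk a 0 b 0 0).baseChange ℚ).conductorNorm ℤ ^ 2 * 2 ^ k ∣ (b * n).natAbs := by
  have hab : a ^ 3 - 27 * b ≠ 0 := by rw [hn]; exact pow_ne_zero 3 hn0
  haveI := isElliptic_mk hb hab
  set W := (WeierstrassCurve.mk a 0 b 0 0).baseChange ℚ with hW
  set D : ℕ := (b * n).natAbs with hD
  have hD0 : D ≠ 0 := Int.natAbs_ne_zero.mpr (mul_ne_zero hb hn0)
  have hN0 : W.conductorNorm ℤ ≠ 0 := (conductorNorm_pos_holds W).ne'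
  have hX0 : W.conductorNorm ℤ ^ 2 * 2 ^ k ≠ 0 := mul_ne_zero (pow_ne_zero 2 hN0) (pow_ne_zero k two_ne_zero)
  have hΔ : b ^ 3 * (a ^ 3 - 27 * b) = (b * n) ^ 3 := by rw [hn]; ring
  rw [← Nat.factorization_le_iff_dvd hX0 hD0]
  intro p
  rw [Nat.factorization_mul (pow_ne_zero 2 hN0) (pow_ne_zero k two_ne_zero), Nat.factorization_pow,
    Nat.factorization_pow]
  simp only [Finsupp.coe_add, Finsupp.coe_smul, Pi.add_apply, Pi.smul_apply, smul_eq_mul]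
  by_cases hp : p.Prime
  swap
  · simp [Nat.factorization_eq_zero_of_not_prime _ hp]
  rw [Nat.Prime.factorization Nat.prime_two, Finsupp.single_apply]
  -- the place above `p`
  obtain ⟨v, hv⟩ := Literature.NumberTheory.EllipticCurves.exists_place ⟨p, hp⟩
  simp only at hv
  have hfac : (W.conductorNorm ℤ).factorization p = W.conductorExponent v := by
    rw [show p = ((⟨p, hp⟩ : Nat.Primes) : ℕ) from rfl, factorization_conductorNorm_primesEquiv_symm,
      show (primesEquiv (R := ℤ)).symm ⟨p, hp⟩ = v from
        (primesEquiv (R := ℤ)).symm_apply_eq.mpr (Subtype.ext hv.symm)]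
  rw [hfac, conductorExponent_mk_eq hc h3 hb hab v, hv]
  -- `p`-adic exponent of `D` from divisibility
  have hdvdD : ∀ j : ℕ, (p : ℤ) ^ j ∣ b * n → j ≤ D.factorization p := fun j hj ↦ by
    rw [← Nat.Prime.pow_dvd_iff_le_factorization hp hD0, hD]
    have : ((p ^ j : ℕ) : ℤ) ∣ b * n := by exact_mod_cast hj
    exact Int.natCast_dvd.mp this
  by_cases hp2 : (2 : ℕ) = p
  · -- `p = 2`: `2 ∣ b`, so `2 ∣ Δ`, `f = 1`, and `2 ^ (k + 2) ∣ b n`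
    subst hp2
    have h2b' : (2 : ℤ) ∣ b := dvd_trans (dvd_pow_self (2 : ℤ) (by omega : k + 2 ≠ 0)) h2b
    have h2Δ : ((2 : ℕ) : ℤ) ∣ b ^ 3 * (a ^ 3 - 27 * b) := by
      have : (2 : ℤ) ∣ b ^ 3 * (a ^ 3 - 27 * b) := dvd_mul_of_dvd_left (dvd_pow h2b' three_ne_zero) _
      exact_mod_cast this
    rw [if_pos h2Δ, if_pos rfl]
    have hbn : (2 : ℤ) ^ (k + 2) ∣ b * n := dvd_mul_of_dvd_left h2b n
    have := hdvdD (k + 2) (by exact_mod_cast hbn)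
    omega
  · rw [if_neg hp2, mul_zero, add_zero]
    split_ifs with hpΔ
    · -- `p ∣ Δ = (b n)³`, so `p ∣ b n`, so `p² ∣ b n`
      have hpint : Prime (p : ℤ) := Nat.prime_iff_prime_int.mp hp
      rw [hΔ] at hpΔ
      have h1 : (p : ℤ) ∣ b * n := hpint.dvd_of_dvd_pow hpΔ
      have := hdvdD 2 (hpow p hp h1)
      omega
    · simp

end Conductor

end BennettYazdani

open BennettYazdani in
/-- **The Szpiro excess is unbounded inside the Bennett–Yazdani family.** For every `B` there is a
semistable elliptic curve `E/ℚ` with `ord_p (Δ_min) ≥ 6` at every prime `p ∣ Δ_min` and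
`|Δ_min (E)| ≥ B · N_E⁶`: along the doubling orbit of `6 · (10, 28)` on `Y² = X³ − 216` the curves
`y² + m xy + b y = x³`, `27 b = m³ − n³`, have `Δ_min = (b n)³` with `b n` powerful and
`2 ^ (3 + 2M) ∣ b` at the `M`-th step, so that `N_E² · 2 ^ (1 + 2M) ∣ b n` and
`|Δ_min| ≥ N_E⁶ · 2 ^ (3 + 6M) ≥ B · N_E⁶` for `M = B`. This is what the construction gives beyond
the vendored "in particular" clause `bennettYazdani2012_minOrd_ge_six` (which alone only yields
`|Δ_min| ≥ N_E⁶`); in particular it refutes `|Δ_min| ≤ C · N_E⁶` for every `C` (the `ε = 0` clause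
of the barrier, cf. `not_szpiro_epsilon_zero_holds` in the sibling `…Holds` file, there via Frey
curves). The printed elementary proof of that clause is Oesterlé's (squaring on the unit circle),
reported in Szpiro, Astérisque 183 (1990), p. 12. [cite: Szpiro1990Discriminant, p. 12] -/
theorem exists_semistable_minOrd_ge_six_excess_ge (B : ℕ) :
    ∃ W : WeierstrassCurve ℚ, W.IsElliptic ∧ W.IsSemistable ℤ ∧
      (∀ v : HeightOneSpectrum ℤ, W.ordMinimalDiscriminant v ≠ 0 → 6 ≤ W.ordMinimalDiscriminant v) ∧
      B * W.conductorNorm ℤ ^ 6 ≤ W.minimalDiscriminantNorm ℤ := by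
  set M := B with hMdef
  obtain ⟨X₀, Y₀, h0, h20, h30⟩ := exists_start
  obtain ⟨hsq, h2, h3⟩ := orbit h0 h20 h30.le M
  obtain ⟨m, b, n, hmbn, hcop, h3m, hb0, hn0, hpow, h2b⟩ :=
    exists_params hsq (by rw [h2]; linarith) h3
  have hk : (1 - padicValRat 2
      ((fun X : ℚ ↦ (X ^ 4 + 1728 * X) / (4 * (X ^ 3 - 216)))^[M] X₀)).toNat = (1 + 2 * M) + 2 := by
    rw [h2]; omega
  rw [hk] at h2b
  have hab : m ^ 3 - 27 * b ≠ 0 := by rw [hmbn]; exact pow_ne_zero 3 hn0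
  haveI := isElliptic_mk hb0 hab
  set W := (WeierstrassCurve.mk m 0 b 0 0).baseChange ℚ with hW
  have hdvd : W.conductorNorm ℤ ^ 2 * 2 ^ (1 + 2 * M) ∣ (b * n).natAbs :=
    conductorNorm_sq_mul_dvd hcop h3m hb0 hmbn hn0 hpow h2b
  have hΔ : W.minimalDiscriminantNorm ℤ = (b * n).natAbs ^ 3 := by
    have hΔ0 : (WeierstrassCurve.mk m 0 b 0 0).Δ ≠ 0 := by
      rw [Δ_mk]; exact mul_ne_zero (pow_ne_zero 3 hb0) hab
    rw [hW, minimalDiscriminantNorm_eq_natAbs_holds _ hΔ0 (isMinimalAt_mk hcop h3m), Δ_mk,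
      show b ^ 3 * (m ^ 3 - 27 * b) = (b * n) ^ 3 by rw [hmbn]; ring, Int.natAbs_pow]
  have hle : (W.conductorNorm ℤ ^ 2 * 2 ^ (1 + 2 * M)) ^ 3 ≤ W.minimalDiscriminantNorm ℤ := by
    rw [hΔ]
    exact Nat.pow_le_pow_left
      (Nat.le_of_dvd (Int.natAbs_pos.mpr (mul_ne_zero hb0 hn0)) hdvd) 3
  refine ⟨W, isElliptic_mk hb0 hab, fun v ↦ isSemistableAt_mk hcop h3m hb0 hab v,
    fun v hv ↦ six_le_ordMinimalDiscriminant_mk hcop h3m hb0 hmbn hn0 hpow v hv, ?_⟩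
  have hB : B ≤ 2 ^ (3 + 6 * M) :=
    le_trans (Nat.lt_two_pow_self).le (Nat.pow_le_pow_right two_pos (by omega))
  calc B * W.conductorNorm ℤ ^ 6 ≤ 2 ^ (3 + 6 * M) * W.conductorNorm ℤ ^ 6 :=
        Nat.mul_le_mul_right _ hB
    _ = (W.conductorNorm ℤ ^ 2 * 2 ^ (1 + 2 * M)) ^ 3 := by ring
    _ ≤ W.minimalDiscriminantNorm ℤ := hle

end Literature.Barriers.ABC
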